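import Summits.QuantumFields.QCD.Theorems.SpectralDefectExtinctionWegnerEstimateCoareaCircleShape

/-!
# Bridge lemma H′ toward stub `coareaWegner` of line `Sketch` (skeleton "ResolventCell", gen 2) for
crux `SpectralDefectExtinction.WegnerEstimate` (item stmt-QuantumFields-8966):
one-link circles move the Hermitian Wilson operator AFFINELY in `(cos t, sin t)`

Bridge lemma B (`coareaWegner_oneLinkCircle_detShape`) recorded only the determinant shape of the
one-link circle family.  The 1-D route also needs the operator itself as a trigonometric matrix
family — to differentiate it (Hellmann–Feynman, bridges A and I), to get Lipschitz sorted eigenvalues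
(Weyl, bridge H: `coareaWegner_trigFamily_ae_differentiableAt`) and to count level crossings:

* `coareaWegner_oneLinkCircle_affine` — for a link curve `c(t) = δ₀ + cos t δ₁ + sin t δ₂` in `SU(3)`,
  `Γ₅ D_W(W[e ↦ W(e) c(t)], m₀, 1) = H₀ + cos t · H₁ + sin t · H₂` for explicit (existentially packaged)
  matrices `H₀, H₁, H₂` independent of `t` (the hop decomposition of bridge B:
  `coareaWegner_gammaFiveWilson_decomp`, `coareaWegner_fwdMatrix_eq_edgeSum`,
  `coareaWegner_edgeSum_update`, and linearity of the one-link hop matrix in the link).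
-/

noncomputable section

namespace Summit.QuantumFields.QCD.Cruxes.WegnerEstimate.ResolventCell

open MeasureTheory
open scoped Matrix BigOperators
open Literature.MathematicalPhysics.QuantumLattice Literature.MathematicalPhysics.QuantumFieldTheory
  Literature.Probability.LatticeModels
open Matrix
open scoped ComplexOrder

/-- **One-link circles are trigonometric matrix families.**  For the Hermitian Wilson operator
`H(U) = Γ₅ D_W(U, m₀, 1)` on the four-torus of any side `L ≥ 1`, a gauge field `W`, a link `e = (z, μ)`
and a curve `c : ℝ → SU(3)` whose matrix is a degree-one trigonometric polynomial
`c(t) = δ₀ + cos t · δ₁ + sin t · δ₂` (e.g. the eight basis circles of `coareaWegner_su3Circles`), there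
are matrices `H₀, H₁, H₂` with `H(W[e ↦ W(e) c(t)]) = H₀ + cos t · H₁ + sin t · H₂` for all `t`. -/
theorem coareaWegner_oneLinkCircle_affine {L : ℕ} [NeZero L] (W : GaugeConfig 4 L SU3) (m₀ : ℝ)
    (z : TorusSite 4 L) (μ : Fin 4) (c : ℝ → SU3) (δ₀ δ₁ δ₂ : Matrix (Fin 3) (Fin 3) ℂ)
    (hc : ∀ t, ((c t : SU3) : Matrix (Fin 3) (Fin 3) ℂ) =
      δ₀ + ((Real.cos t : ℝ) : ℂ) • δ₁ + ((Real.sin t : ℝ) : ℂ) • δ₂) :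
    ∃ H₀ H₁ H₂ : Matrix (QuarkIdx L) (QuarkIdx L) ℂ, ∀ t : ℝ,
      spinorLift gammaFive * wilsonDirac (fundamentalRep (Fin 3))
          (Function.update W (z, μ) (W (z, μ) * c t)) m₀ 1 =
        H₀ + ((Real.cos t : ℝ) : ℂ) • H₁ + ((Real.sin t : ℝ) : ℂ) • H₂ := by
  -- the forward-hop matrix of the edge `e'` with colour matrix `M`
  set Fe : Edge 4 L → Matrix (Fin 3) (Fin 3) ℂ → Matrix (QuarkIdx L) (QuarkIdx L) ℂ := fun e' M =>
    Matrix.of fun p q : QuarkIdx L =>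
      if p.1 = e'.1 ∧ q.1 = Literature.MathematicalPhysics.QuantumFieldTheory.Site.shift e'.1 e'.2 then
        -(1 / 2 : ℂ) * ((![1, 1, -1, -1] : Fin 4 → ℂ) p.2.2 *
          (((1 : ℝ) : ℂ) • (1 : Matrix (Fin 4) (Fin 4) ℂ) - euclideanGamma e'.2) p.2.2 q.2.2 * M p.2.1 q.2.1)
      else 0 with hFe
  have hρ : ∀ u : SU3, fundamentalRep (Fin 3) u ∈ Matrix.unitaryGroup (Fin 3) ℂ :=
    fun u => fundamentalRep_mem_unitaryGroup u
  -- (i) matrix hop decomposition, edge by edge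
  have h1 : ∀ U : GaugeConfig 4 L SU3,
      spinorLift gammaFive * wilsonDirac (fundamentalRep (Fin 3)) U m₀ 1 =
        diagonal (fun p : QuarkIdx L => ((m₀ + 4 * 1 : ℝ) : ℂ) * (![1, 1, -1, -1] : Fin 4 → ℂ) p.2.2) +
          (∑ e', Fe e' ((U e' : SU3) : Matrix (Fin 3) (Fin 3) ℂ)) +
          (∑ e', Fe e' ((U e' : SU3) : Matrix (Fin 3) (Fin 3) ℂ))ᴴ := by
    intro U
    rw [coareaWegner_gammaFiveWilson_decomp _ hρ, coareaWegner_fwdMatrix_eq_edgeSum]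
    simp only [hFe, fundamentalRep_apply]
  -- (ii) isolate the link `e = (z, μ)`
  have h2 : ∀ v : SU3,
      ∑ e', Fe e' ((Function.update W (z, μ) v e' : SU3) : Matrix (Fin 3) (Fin 3) ℂ) =
        Fe (z, μ) (v : Matrix (Fin 3) (Fin 3) ℂ) +
          ∑ e' ∈ Finset.univ \ {(z, μ)}, Fe e' ((W e' : SU3) : Matrix (Fin 3) (Fin 3) ℂ) :=
    fun v => coareaWegner_edgeSum_update (fun e' (u : SU3) => Fe e' (u : Matrix (Fin 3) (Fin 3) ℂ)) W (z, μ) v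
  -- (iii) the one-link hop matrix is linear in the colour matrix
  have h3 : ∀ (a b : ℂ) (M₀ M₁ M₂ : Matrix (Fin 3) (Fin 3) ℂ),
      Fe (z, μ) (M₀ + a • M₁ + b • M₂) = Fe (z, μ) M₀ + a • Fe (z, μ) M₁ + b • Fe (z, μ) M₂ := by
    intro a b M₀ M₁ M₂
    ext p q
    simp only [hFe, of_apply, Matrix.add_apply, Matrix.smul_apply, smul_eq_mul]
    split_ifs <;> ring
  -- abbreviations
  set We : Matrix (Fin 3) (Fin 3) ℂ := ((W (z, μ) : SU3) : Matrix (Fin 3) (Fin 3) ℂ) with hWe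
  set R : Matrix (QuarkIdx L) (QuarkIdx L) ℂ :=
    ∑ e' ∈ Finset.univ \ {(z, μ)}, Fe e' ((W e' : SU3) : Matrix (Fin 3) (Fin 3) ℂ) with hR
  set D : Matrix (QuarkIdx L) (QuarkIdx L) ℂ :=
    diagonal (fun p : QuarkIdx L => ((m₀ + 4 * 1 : ℝ) : ℂ) * (![1, 1, -1, -1] : Fin 4 → ℂ) p.2.2) with hD
  refine ⟨D + (Fe (z, μ) (We * δ₀) + R) + (Fe (z, μ) (We * δ₀) + R)ᴴ,
    Fe (z, μ) (We * δ₁) + (Fe (z, μ) (We * δ₁))ᴴ, Fe (z, μ) (We * δ₂) + (Fe (z, μ) (We * δ₂))ᴴ, fun t => ?_⟩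
  have hX : ((W (z, μ) * c t : SU3) : Matrix (Fin 3) (Fin 3) ℂ) =
      We * δ₀ + ((Real.cos t : ℝ) : ℂ) • (We * δ₁) + ((Real.sin t : ℝ) : ℂ) • (We * δ₂) := by
    rw [Submonoid.coe_mul, hc, Matrix.mul_add, Matrix.mul_add, Matrix.mul_smul, Matrix.mul_smul]
  have hcos : star ((Real.cos t : ℝ) : ℂ) = ((Real.cos t : ℝ) : ℂ) := Complex.conj_ofReal _
  have hsin : star ((Real.sin t : ℝ) : ℂ) = ((Real.sin t : ℝ) : ℂ) := Complex.conj_ofReal _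
  rw [h1, h2, hX, h3]
  simp only [conjTranspose_add, conjTranspose_smul, hcos, hsin, smul_add]
  abel

end Summit.QuantumFields.QCD.Cruxes.WegnerEstimate.ResolventCell

end
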